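import Summits.MatrixMultiplication.OmegaCensus.RadonProjection
import HarnessLib

/-!
# The three-set Radon identity (L3)

ω-census `pub-omega`, family (b3), seat pub-omega-group gen 7.  Framing: lottery ticket; floor = certified bounds/negative
ranges.  VALUE: kernel form of identity (L3) of `THEORY-radon-g7.md` R6.2 (the necessary condition enumerated by the
three-set Radon engine); NOT progress on ω.

For finite `W, X, Y ⊆ A`, a homomorphism `φ : A →+ B` and fibre counts `n_Z(t) = |Z ∩ φ⁻¹(t)|`:
* `card_fibre_signed_sumset₃`: if `(w,x,y) ↦ ε₁w + ε₂x + ε₃y` (a fixed sign pattern, given as a function `g` with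
  `φ (g p) = σ (φ w) (φ x) (φ y)` and `σ v · u` solvable for the middle argument) is injective on `W × X × Y`, the fibre
  of its image over `t` has `Σ_{v,u} n_W(v)·n_X(r v u)·n_Y(u)` elements, `r v u` the unique middle value;
* **`radon_identity₃`**: if `−W+X+Y`, `W−X+Y`, `W+X−Y` are each direct, pairwise disjoint, and cover `A ∖ {x₀}`, then
  `Σ_u Σ_v n_W(v)·(n_X(t−u+v) + n_X(v+u−t) + n_X(t+u−v))·n_Y(u) + [φ x₀ = t] = |φ⁻¹(t)|` for every `t`.
With `CubeSymmetricForm.cube_symmetric_form_of_law` (law cube triple ⇒ such `W, X, Y, x₀`) this is the kernel chain behind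
the three-set certificates (ℤ₁₇² (3,4,8)/(4,4,6), ℤ₁₉² (3,4,10)/(3,5,8)/(4,5,6), ℤ₅²×ℤ₁₃ (3,6,6)).
-/

namespace Summit.MatrixMultiplication.OmegaCensus

open Finset

section Radon3

variable {A B : Type*} [AddCommGroup A] [DecidableEq A] [AddCommGroup B] [Fintype B] [DecidableEq B]

omit [DecidableEq A] in
/-- Fibre counting of a set of triples by the values of `φ` on the first and third coordinates. [folklore] -/
theorem card_filter_triples_eq_sum (φ : A →+ B) (W X Y : Finset A) (P : A → A → A → Prop)
    [DecidablePred fun p : A × A × A => P p.1 p.2.1 p.2.2]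
    (r : B → B → B) (hP : ∀ w x y, P w x y ↔ φ x = r (φ w) (φ y)) :
    ((W ×ˢ X ×ˢ Y).filter fun p : A × A × A => P p.1 p.2.1 p.2.2).card =
      ∑ u : B, ∑ v : B, (W.filter fun a => φ a = v).card * (X.filter fun a => φ a = r v u).card *
        (Y.filter fun a => φ a = u).card := by
  rw [card_eq_sum_card_fiberwise (f := fun p : A × A × A => (φ p.2.2, φ p.1)) (t := (univ : Finset (B × B)))
    (fun _ _ => mem_univ _), ← univ_product_univ, sum_product]
  refine sum_congr rfl fun u _ => sum_congr rfl fun v _ => ?_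
  have : ((W ×ˢ X ×ˢ Y).filter fun p : A × A × A => P p.1 p.2.1 p.2.2).filter
      (fun p : A × A × A => (φ p.2.2, φ p.1) = (u, v)) =
      (W.filter fun a => φ a = v) ×ˢ (X.filter fun a => φ a = r v u) ×ˢ (Y.filter fun a => φ a = u) := by
    ext ⟨w, x, y⟩
    simp only [mem_filter, mem_product, hP, Prod.mk.injEq]
    constructor
    · rintro ⟨⟨⟨hw, hx, hy⟩, hxe⟩, hu, hv⟩
      exact ⟨⟨hw, hv⟩, ⟨hx, by rw [hxe, hu, hv]⟩, hy, hu⟩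
    · rintro ⟨⟨hw, hv⟩, ⟨hx, hxe⟩, hy, hu⟩
      exact ⟨⟨⟨hw, hx, hy⟩, by rw [hxe, hu, hv]⟩, hu, hv⟩
  rw [this, card_product, card_product, mul_assoc]

omit [Fintype B] in
/-- The fibre of an injective image of triples is the image of the fibre. [folklore] -/
theorem card_filter_image₃_of_injOn (φ : A →+ B) {S : Finset (A × A × A)} {g : A × A × A → A}
    (hg : Set.InjOn g ↑S) (t : B) :
    ((S.image g).filter fun a => φ a = t).card = (S.filter fun p => φ (g p) = t).card := by
  rw [filter_image, card_image_of_injOn (hg.mono (by intro p hp; exact (mem_filter.1 (mem_coe.1 hp)).1))]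

/-- Fibres of the direct signed sumset `−W + X + Y`. [folklore] -/
theorem card_fibre_box₁ (φ : A →+ B) {W X Y : Finset A}
    (hinj : Set.InjOn (fun p : A × A × A => -p.1 + p.2.1 + p.2.2) ↑(W ×ˢ X ×ˢ Y)) (t : B) :
    (((W ×ˢ X ×ˢ Y).image fun p : A × A × A => -p.1 + p.2.1 + p.2.2).filter fun a => φ a = t).card =
      ∑ u : B, ∑ v : B, (W.filter fun a => φ a = v).card * (X.filter fun a => φ a = t - u + v).card *
        (Y.filter fun a => φ a = u).card := by
  rw [card_filter_image₃_of_injOn φ hinj t]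
  exact card_filter_triples_eq_sum φ W X Y (fun w x y => φ (-w + x + y) = t) (fun v u => t - u + v)
    (fun w x y => by
      rw [map_add, map_add, map_neg]
      constructor
      · intro h; rw [← h]; abel
      · intro h; rw [h]; abel)

/-- Fibres of the direct signed sumset `W − X + Y`. [folklore] -/
theorem card_fibre_box₂ (φ : A →+ B) {W X Y : Finset A}
    (hinj : Set.InjOn (fun p : A × A × A => p.1 - p.2.1 + p.2.2) ↑(W ×ˢ X ×ˢ Y)) (t : B) :
    (((W ×ˢ X ×ˢ Y).image fun p : A × A × A => p.1 - p.2.1 + p.2.2).filter fun a => φ a = t).card =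
      ∑ u : B, ∑ v : B, (W.filter fun a => φ a = v).card * (X.filter fun a => φ a = v + u - t).card *
        (Y.filter fun a => φ a = u).card := by
  rw [card_filter_image₃_of_injOn φ hinj t]
  exact card_filter_triples_eq_sum φ W X Y (fun w x y => φ (w - x + y) = t) (fun v u => v + u - t)
    (fun w x y => by
      rw [map_add, map_sub]
      constructor
      · intro h; rw [← h]; abel
      · intro h; rw [h]; abel)

/-- Fibres of the direct signed sumset `W + X − Y`. [folklore] -/
theorem card_fibre_box₃ (φ : A →+ B) {W X Y : Finset A}
    (hinj : Set.InjOn (fun p : A × A × A => p.1 + p.2.1 - p.2.2) ↑(W ×ˢ X ×ˢ Y)) (t : B) :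
    (((W ×ˢ X ×ˢ Y).image fun p : A × A × A => p.1 + p.2.1 - p.2.2).filter fun a => φ a = t).card =
      ∑ u : B, ∑ v : B, (W.filter fun a => φ a = v).card * (X.filter fun a => φ a = t + u - v).card *
        (Y.filter fun a => φ a = u).card := by
  rw [card_filter_image₃_of_injOn φ hinj t]
  exact card_filter_triples_eq_sum φ W X Y (fun w x y => φ (w + x - y) = t) (fun v u => t + u - v)
    (fun w x y => by
      rw [map_sub, map_add]
      constructor
      · intro h; rw [← h]; abel
      · intro h; rw [h]; abel)

variable [Fintype A]

/-- **The three-set Radon identity (L3).** [folklore] -/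
theorem radon_identity₃ (φ : A →+ B) {W X Y : Finset A} {x₀ : A}
    (h₁ : Set.InjOn (fun p : A × A × A => -p.1 + p.2.1 + p.2.2) ↑(W ×ˢ X ×ˢ Y))
    (h₂ : Set.InjOn (fun p : A × A × A => p.1 - p.2.1 + p.2.2) ↑(W ×ˢ X ×ˢ Y))
    (h₃ : Set.InjOn (fun p : A × A × A => p.1 + p.2.1 - p.2.2) ↑(W ×ˢ X ×ˢ Y))
    (d₁₂ : Disjoint ((W ×ˢ X ×ˢ Y).image fun p : A × A × A => -p.1 + p.2.1 + p.2.2)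
      ((W ×ˢ X ×ˢ Y).image fun p : A × A × A => p.1 - p.2.1 + p.2.2))
    (d₁₃ : Disjoint ((W ×ˢ X ×ˢ Y).image fun p : A × A × A => -p.1 + p.2.1 + p.2.2)
      ((W ×ˢ X ×ˢ Y).image fun p : A × A × A => p.1 + p.2.1 - p.2.2))
    (d₂₃ : Disjoint ((W ×ˢ X ×ˢ Y).image fun p : A × A × A => p.1 - p.2.1 + p.2.2)
      ((W ×ˢ X ×ˢ Y).image fun p : A × A × A => p.1 + p.2.1 - p.2.2))
    (hcover : ((W ×ˢ X ×ˢ Y).image fun p : A × A × A => -p.1 + p.2.1 + p.2.2) ∪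
      ((W ×ˢ X ×ˢ Y).image fun p : A × A × A => p.1 - p.2.1 + p.2.2) ∪
      ((W ×ˢ X ×ˢ Y).image fun p : A × A × A => p.1 + p.2.1 - p.2.2) = univ.erase x₀) (t : B) :
    (∑ u : B, ∑ v : B, (W.filter fun a => φ a = v).card *
        ((X.filter fun a => φ a = t - u + v).card + (X.filter fun a => φ a = v + u - t).card +
          (X.filter fun a => φ a = t + u - v).card) * (Y.filter fun a => φ a = u).card) +
      (if φ x₀ = t then 1 else 0) = (univ.filter fun a : A => φ a = t).card := by
  set P := (W ×ˢ X ×ˢ Y).image fun p : A × A × A => -p.1 + p.2.1 + p.2.2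
  set Q := (W ×ˢ X ×ˢ Y).image fun p : A × A × A => p.1 - p.2.1 + p.2.2
  set R := (W ×ˢ X ×ˢ Y).image fun p : A × A × A => p.1 + p.2.1 - p.2.2
  have hsum : (∑ u : B, ∑ v : B, (W.filter fun a => φ a = v).card *
        ((X.filter fun a => φ a = t - u + v).card + (X.filter fun a => φ a = v + u - t).card +
          (X.filter fun a => φ a = t + u - v).card) * (Y.filter fun a => φ a = u).card) =
      (P.filter fun a => φ a = t).card + (Q.filter fun a => φ a = t).card + (R.filter fun a => φ a = t).card := by
    rw [card_fibre_box₁ φ h₁, card_fibre_box₂ φ h₂, card_fibre_box₃ φ h₃, ← sum_add_distrib, ← sum_add_distrib]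
    refine sum_congr rfl fun u _ => ?_
    rw [← sum_add_distrib, ← sum_add_distrib]
    exact sum_congr rfl fun v _ => by ring
  rw [hsum]
  have hdPQ : Disjoint (P.filter fun a => φ a = t) (Q.filter fun a => φ a = t) := disjoint_filter_filter d₁₂
  have hdPR : Disjoint (P.filter fun a => φ a = t) (R.filter fun a => φ a = t) := disjoint_filter_filter d₁₃
  have hdQR : Disjoint (Q.filter fun a => φ a = t) (R.filter fun a => φ a = t) := disjoint_filter_filter d₂₃
  have hunion : (univ.filter fun a : A => φ a = t) =
      ((P ∪ Q ∪ R).filter fun a => φ a = t) ∪ (({x₀} : Finset A).filter fun a => φ a = t) := by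
    rw [← filter_union, hcover]
    congr 1
    ext a
    simp only [mem_union, mem_erase, mem_univ, mem_singleton, and_true]
    tauto
  have hdisj0 : Disjoint ((P ∪ Q ∪ R).filter fun a => φ a = t) (({x₀} : Finset A).filter fun a => φ a = t) := by
    apply disjoint_filter_filter
    rw [hcover, disjoint_singleton_right]
    exact fun h => (mem_erase.1 h).1 rfl
  rw [hunion, card_union_of_disjoint hdisj0, filter_union, filter_union,
    card_union_of_disjoint (disjoint_union_left.2 ⟨hdPR, hdQR⟩), card_union_of_disjoint hdPQ]
  congr 1
  rw [filter_singleton]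
  split_ifs <;> simp

end Radon3

end Summit.MatrixMultiplication.OmegaCensus
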